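import Summits.SmoothPoincare4.SmoothPoincare4.Theorems.ConvexBisectionAcyclicBisectionExistsHgapTwistPointwise
import Summits.SmoothPoincare4.SmoothPoincare4.Theorems.ConvexBisectionAcyclicBisectionExistsOrseamPageDet
import HarnessLib

/-!
# Hgap ▸ part B (page twisting of the straightened dual framed knot), brick G2-3 (character at the belt point):
# the orientation character of the pushed belt-tube chart at a belt point is the page sign `σ̂`
(wave 6, crux stmt-SmoothPoincare4-10508, line `modp-braid-orbits`, stub `stub_T3_dualPresentation` (T3)
▸ node `Hgap` ▸ part B `helper_Hgap_twisting`; registered sub-goal `helper_det4_beltFrame_sign`)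

The TRANSFER step G2-3 (`G2-REPORT.md` §4 (R6)) pins the page sign `σ̂ = sign ⟪Λ N_B, iT⟫` of the pushed
belt framing (the `σ` of `helper_beltFrame_pointwise`, `…HgapTwistPointwise.lean`) by continuity of the
`det4`-ORIENTATION CHARACTER `χ = det4 (∇rho, ∂₀Γ̂, ∂₁Γ̂, ∂_φΓ̂)` of the chart `Γ̂ (m, φ) = R₁ (seam (β♭ (e^{2πiφ}, m)))`
from the glued points (where it factors through X3's `s₀` and the tube side) to the belt circle `m = 0`.  This
file is the belt-point end of that continuity argument, pure linear algebra in `ℝ⁴ = ℂ²` at a flat page point: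

**`det4_beltFrame_sign`** (registered `helper_det4_beltFrame_sign`): with `Λ = ∂_m Γ̂ (0, φ)` (tangent to the
boundary, rows `4‖dΦ‖² ⟪Λ X, n⟫ = ⟪L, X⟫`, `L ≠ 0`, meeting `ℝ T` only at `0`) and `T = ∂_φ Γ̂` a non-zero
page tangent, `0 < ⟪Λ N_B, iT⟫ · det4 (∇rho (q), Λ e₀, Λ e₁, T)`, i.e. `sign χ (0, φ) = σ̂`.
Proof: `|L|² e₀ = L₁ N_B + L₀ L`, `|L|² e₁ = -L₀ N_B + L₁ L`; `Λ N_B = (Re z) T + (Im z) iT` (a page tangent,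
`dPhi_eq_zero_of_normal_eq_zero`), `Λ L = a T + b iT + γ n` with `γ = ⟪Λ L, n⟫/‖n‖² > 0`; recombining the
last three slots (`det4_lincomb₃`) gives `det4 (∇rho, Λ e₀, Λ e₁, T) = (γ Im z / |L|²) · det4 (∇rho, T, iT, n)`,
and `det4 (∇rho, T, iT, n) > 0` (X4 `det4_pageFrame_pos`), `⟪Λ N_B, iT⟫ = Im z ‖T‖²`.

Everything is proved; no named facts, no `sorry`.  References: J. B. Etnyre, T. Fuller, IMRN 2006, Thm. 1
(proof, p. 8) [EtnyreFuller2006]; R. İ. Baykur, AGT 6 (2006), §2.3 [Baykur2006].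
-/

noncomputable section

set_option linter.dupNamespace false

open scoped ComplexConjugate RealInnerProductSpace
open Set Function Complex
open Literature.Topology.FourManifolds Literature.Topology.FourManifolds.LefschetzBase
  Literature.Geometry.Symplectic

namespace Summit.SmoothPoincare4.SmoothPoincare4.Theorems.AcyclicBisectionExists.ModpBraidOrbits

variable {g : ℕ}

/-- The two coordinate vectors through the in-page normal `N_B = L₁ e₀ − L₀ e₁` and `L`:
`|L|² e₀ = L₁ N_B + L₀ L`, `|L|² e₁ = −L₀ N_B + L₁ L`. [folklore] -/
theorem planeE_eq_combo (L : EuclideanSpace ℝ (Fin 2)) :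
    (L 0 ^ 2 + L 1 ^ 2) • planeE0 = L 1 • (L 1 • planeE0 - L 0 • planeE1) + L 0 • L ∧
    (L 0 ^ 2 + L 1 ^ 2) • planeE1 = -(L 0) • (L 1 • planeE0 - L 0 • planeE1) + L 1 • L := by
  constructor
  · ext i
    fin_cases i <;> simp [planeE0, planeE1] <;> ring
  · ext i
    fin_cases i <;> simp [planeE0, planeE1] <;> ring

/-- **The orientation character of the pushed belt-tube chart at a belt point is the page sign `σ̂`**
(brick G2-3, belt-point end of the transfer): `0 < ⟪Λ N_B, iT⟫ · det4 (∇rho (q), Λ e₀, Λ e₁, T)`.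
[cite: EtnyreFuller2006, Thm. 1 (proof, p. 8)] -/
theorem det4_beltFrame_sign {q T : EuclideanSpace ℝ (Fin 4)} {Λ : EuclideanSpace ℝ (Fin 2) →L[ℝ] EuclideanSpace ℝ (Fin 4)}
    {L : EuclideanSpace ℝ (Fin 2)} {c : ℂ} (hc : ‖c‖ = 1) (hw : w g q = c / 2) (hflat : ‖cx q‖ ^ 2 < 4)
    (hT0 : T ≠ 0) (hT : dPhiX g q * cx T + dPhiY q * cy T = 0)
    (hρ : ∀ X, fderiv ℝ (rho g) q (Λ X) = 0)
    (hL : ∀ X, 4 * (‖dPhiX g q‖ ^ 2 + ‖dPhiY q‖ ^ 2) * inner ℝ (Λ X) (horizNormal g q) = inner ℝ L X)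
    (hL0 : L ≠ 0) (hinj : ∀ (X : EuclideanSpace ℝ (Fin 2)) (a : ℝ), Λ X = a • T → X = 0) :
    0 < inner ℝ (Λ (L 1 • planeE0 - L 0 • planeE1)) (cplxJ T) *
      det4 (gradient (rho g) q) (Λ planeE0) (Λ planeE1) T := by
  have hq : q ≠ 0 := ne_zero_of_w_eq_half hc hw
  have hw0 : w g q ≠ 0 := by
    rw [hw]; intro h0
    have : c = 0 := by linear_combination 2 * h0
    rw [this, norm_zero] at hc; exact zero_ne_one hc
  have hN : 0 < 4 * (‖dPhiX g q‖ ^ 2 + ‖dPhiY q‖ ^ 2) := by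
    have := normSq_dPhi_ne_zero (g := g) hq
    positivity
  have hS : 0 < L 0 ^ 2 + L 1 ^ 2 := by
    by_contra h
    apply hL0
    have h0 : L 0 = 0 := by nlinarith [sq_nonneg (L 0), sq_nonneg (L 1)]
    have h1 : L 1 = 0 := by nlinarith [sq_nonneg (L 0), sq_nonneg (L 1)]
    ext i; fin_cases i
    · exact h0
    · exact h1
  set NB : EuclideanSpace ℝ (Fin 2) := L 1 • planeE0 - L 0 • planeE1 with hNB
  set n := horizNormal g q with hn
  set P := det4 (gradient (rho g) q) T (cplxJ T) n with hP
  have hPpos : 0 < P := det4_pageFrame_pos hq hflat hw0 hT0 hT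
  -- (a) `Λ N_B = (Re z) T + (Im z) iT`, `Q = Im z ‖T‖²`, `Im z ≠ 0`
  have hQ0 : inner ℝ (Λ NB) (cplxJ T) ≠ 0 := beltFrame_Q_ne_zero hc hw hflat hT0 hT hρ hL hL0 hinj
  have hNn : inner ℝ (Λ NB) n = 0 := by
    have h := hL NB
    have h0 : inner ℝ L NB = 0 := by
      rw [hNB, inner_sub_right, real_inner_smul_right, real_inner_smul_right]
      simp [EuclideanSpace.inner_single_right, planeE0, planeE1]
      ring
    rw [h0] at h
    exact (mul_eq_zero.1 h).resolve_left hN.ne'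
  have hNL : dPhiX g q * cx (Λ NB) + dPhiY q * cy (Λ NB) = 0 :=
    dPhi_eq_zero_of_normal_eq_zero hc hw hflat (hρ NB) hNn
  set z : ℂ := (cx (Λ NB) * conj (cx T) + cy (Λ NB) * conj (cy T)) / ((‖T‖ ^ 2 : ℝ) : ℂ) with hz
  have hrep : Λ NB = z.re • T + z.im • cplxJ T := by
    rw [← mk_mul_eq_add_smul]; exact eq_mk_mul_of_dPhi_eq_zero hq hT0 hT hNL
  have hQ : inner ℝ (Λ NB) (cplxJ T) = z.im * ‖T‖ ^ 2 := by
    rw [hrep, inner_add_left, real_inner_smul_left, real_inner_smul_left, inner_self_cplxJ,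
      inner_cplxJ_cplxJ_self, mul_zero, zero_add]
  -- (b) `Λ L = a T + b iT + γ n`, `γ > 0`
  have hgradT : ⟪gradient (rho g) q, T⟫ = 0 := by
    rw [inner_gradient_eq_fderiv]; exact fderiv_rho_pageTangent hflat hT
  have hgradU : ⟪gradient (rho g) q, cplxJ T⟫ = 0 := by
    rw [inner_gradient_eq_fderiv]; exact fderiv_rho_pageTangent hflat (dPhi_cplxJ_pageTangent hT)
  have hgradn : ⟪gradient (rho g) q, n⟫ = 0 := by
    rw [inner_gradient_eq_fderiv]; exact fderiv_rho_horizNormal hq hflat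
  have hgradL : ⟪gradient (rho g) q, Λ L⟫ = 0 := by
    rw [inner_gradient_eq_fderiv]; exact hρ L
  obtain ⟨a, b, γ, hΛL⟩ := exists_coeffs_of_tangent hPpos.ne' hgradT hgradU hgradn hgradL
  have hTn : inner ℝ T n = 0 := by
    rw [hn, inner_horizNormal, hT, mul_zero, Complex.zero_im, zero_div]
  have hUn : inner ℝ (cplxJ T) n = 0 := inner_cplxJ_horizNormal_eq_zero hT
  have hnn : 0 < inner ℝ n n := by
    rw [real_inner_self_eq_norm_sq]
    have h1 := norm_horizNormal_sq_of_page (g := g) hc hw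
    have h2 : 0 < ‖horizNormal g q‖ ^ 2 := by
      by_contra h
      have h0 : ‖horizNormal g q‖ ^ 2 = 0 := le_antisymm (not_lt.1 h) (sq_nonneg _)
      rw [h0, zero_mul] at h1
      exact zero_ne_one h1
    exact h2
  have hγ : 0 < γ := by
    have h1 : inner ℝ (Λ L) n = γ * inner ℝ n n := by
      rw [hΛL, inner_add_left, inner_add_left, real_inner_smul_left, real_inner_smul_left,
        real_inner_smul_left, hTn, hUn, mul_zero, mul_zero, zero_add, zero_add]
    have h2 := hL L
    have h3 : 0 < inner ℝ L L := by
      rw [real_inner_self_eq_norm_sq]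
      have : ‖L‖ ≠ 0 := norm_ne_zero_iff.2 hL0
      positivity
    have h4 : 0 < γ * inner ℝ n n := by
      have : 0 < 4 * (‖dPhiX g q‖ ^ 2 + ‖dPhiY q‖ ^ 2) * (γ * inner ℝ n n) := by rw [← h1, h2]; exact h3
      exact pos_of_mul_pos_right this hN.le
    exact pos_of_mul_pos_left h4 hnn.le
  -- (c) the coordinate vectors `Λ e₀`, `Λ e₁` in the frame `(T, iT, n)`
  obtain ⟨he0, he1⟩ := planeE_eq_combo L
  set S := L 0 ^ 2 + L 1 ^ 2 with hSdef
  have hΛe0 : Λ planeE0 = ((L 1 * z.re + L 0 * a) / S) • T + ((L 1 * z.im + L 0 * b) / S) • cplxJ T +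
      ((L 0 * γ) / S) • n := by
    have h : S • Λ planeE0 = L 1 • Λ NB + L 0 • Λ L := by
      rw [← map_smul, he0, map_add, map_smul, map_smul]
    have h' : Λ planeE0 = S⁻¹ • (L 1 • Λ NB + L 0 • Λ L) := by
      rw [← h, smul_smul, inv_mul_cancel₀ hS.ne', one_smul]
    rw [h', hrep, hΛL]
    simp only [smul_add, smul_smul, div_eq_inv_mul]
    module
  have hΛe1 : Λ planeE1 = ((-(L 0) * z.re + L 1 * a) / S) • T + ((-(L 0) * z.im + L 1 * b) / S) • cplxJ T +
      ((L 1 * γ) / S) • n := by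
    have h : S • Λ planeE1 = -(L 0) • Λ NB + L 1 • Λ L := by
      rw [← map_smul, he1, map_add, map_smul, map_smul]
    have h' : Λ planeE1 = S⁻¹ • (-(L 0) • Λ NB + L 1 • Λ L) := by
      rw [← h, smul_smul, inv_mul_cancel₀ hS.ne', one_smul]
    rw [h', hrep, hΛL]
    simp only [smul_add, smul_smul, div_eq_inv_mul]
    module
  have hTT : T = (1 : ℝ) • T + (0 : ℝ) • cplxJ T + (0 : ℝ) • n := by simp
  have hdet : det4 (gradient (rho g) q) (Λ planeE0) (Λ planeE1) T = (γ * z.im / S) * P := by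
    have e : det4 (gradient (rho g) q) (Λ planeE0) (Λ planeE1) T =
        det4 (gradient (rho g) q)
          (((L 1 * z.re + L 0 * a) / S) • T + ((L 1 * z.im + L 0 * b) / S) • cplxJ T + ((L 0 * γ) / S) • n)
          (((-(L 0) * z.re + L 1 * a) / S) • T + ((-(L 0) * z.im + L 1 * b) / S) • cplxJ T + ((L 1 * γ) / S) • n)
          ((1 : ℝ) • T + (0 : ℝ) • cplxJ T + (0 : ℝ) • n) := by
      rw [← hΛe0, ← hΛe1, ← hTT]
    rw [e, det4_lincomb₃, hP]
    congr 1
    field_simp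
    ring
  -- (d) conclude
  rw [hQ, hdet]
  have hzim : z.im ≠ 0 := by
    intro h0; apply hQ0; rw [hQ, h0, zero_mul]
  have h1 : 0 < z.im * z.im := by nlinarith [sq_nonneg z.im, sq_pos_of_ne_zero hzim]
  have h2 : 0 < ‖T‖ ^ 2 := by
    have : ‖T‖ ≠ 0 := norm_ne_zero_iff.2 hT0
    positivity
  have e : z.im * ‖T‖ ^ 2 * (γ * z.im / S * P) = (z.im * z.im) * ‖T‖ ^ 2 * γ * P / S := by ring
  rw [e]
  positivity

/-- **Sub-goal `helper_det4_beltFrame_sign` of stub `stub_T3_dualPresentation`** (T3 ▸ node `Hgap` ▸ part B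
`helper_Hgap_twisting`, brick G2-3, belt-point end of the transfer; wave 6, lead c5): at a belt point the
`det4`-orientation character of the pushed belt-tube chart has the page sign `σ̂`:
`0 < ⟪Λ N_B, iT⟫ · det4 (∇rho, Λ e₀, Λ e₁, T)`. [cite: EtnyreFuller2006, Thm. 1 (proof, p. 8)] -/
theorem helper_det4_beltFrame_sign : ∀ (g : ℕ) (q T : EuclideanSpace ℝ (Fin 4)) (Λ : EuclideanSpace ℝ (Fin 2) →L[ℝ] EuclideanSpace ℝ (Fin 4)) (L : EuclideanSpace ℝ (Fin 2)) (c : ℂ), ‖c‖ = 1 → Literature.Topology.FourManifolds.LefschetzBase.w g q = c / 2 → ‖Literature.Topology.FourManifolds.LefschetzBase.cx q‖ ^ 2 < 4 → T ≠ 0 → Literature.Topology.FourManifolds.LefschetzBase.dPhiX g q * Literature.Topology.FourManifolds.LefschetzBase.cx T + Literature.Topology.FourManifolds.LefschetzBase.dPhiY q * Literature.Topology.FourManifolds.LefschetzBase.cy T = 0 → (∀ X, fderiv ℝ (Literature.Topology.FourManifolds.LefschetzBase.rho g) q (Λ X) = 0) → (∀ X, 4 * (‖Literature.Topology.FourManifolds.LefschetzBase.dPhiX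 g q‖ ^ 2 + ‖Literature.Topology.FourManifolds.LefschetzBase.dPhiY q‖ ^ 2) * inner ℝ (Λ X) (Literature.Topology.FourManifolds.LefschetzBase.horizNormal g q) = inner ℝ L X) → L ≠ 0 → (∀ (X : EuclideanSpace ℝ (Fin 2)) (a : ℝ), Λ X = a • T → X = 0) → 0 < inner ℝ (Λ (L 1 • Literature.Topology.FourManifolds.planeE0 - L 0 • Literature.Topology.FourManifolds.planeE1)) (Literature.Topology.FourManifolds.LefschetzBase.cplxJ T) * Literature.Geometry.Symplectic.det4 (gradient (Literature.Topology.FourManifolds.LefschetzBase.rho g) q) (Λ Literature.Topology.FourManifolds.planeE0) (Λ Literature.Topology.FourManifolds.planeE1) T :=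
  fun _ _ _ _ _ _ hc hw hflat hT0 hT hρ hL hL0 hinj => det4_beltFrame_sign hc hw hflat hT0 hT hρ hL hL0 hinj

end Summit.SmoothPoincare4.SmoothPoincare4.Theorems.AcyclicBisectionExists.ModpBraidOrbits

end
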